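import Literature.Topology.FourManifolds.TrisectionsTriNormalForm
import Literature.Topology.FourManifolds.TrisectionsSectorRecognition
import Literature.Topology.FourManifolds.TrisectionsSectorClauses
import Literature.Topology.FourManifolds.TrisectionsAmbientMorseLemmas
import Literature.Topology.FourManifolds.AdaptedMorseConnected

/-!
# Stub `stub_thetaData` of line `lp-by-sphere-system-surgery` for crux `AgkCor6Sufficiency`
(item stmt-SmoothPoincare4-10894, routes CongruenceShadows / GroupTrisection; lead reshape r5)

**Θ-standard data of a Gay–Kirby trisection** (tree plumbing).  For a trisection with corners
`S` of a closed smooth `4`-manifold `X` we exhibit ONE normal frame `(u, v, ρ, U, O)` along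
`F = ⋂ S l` in which `S` is a `TriNormalForm S 0 1 2` with counts `handleCount 1 (k m)`
(`IsGKTrisection.exists_triNormalForm`), and for each sector `S m` a corner-slice atlas over that
frame (relabelled normal coordinates `(v - u, -u)` for `S 1` and `(-v, u - v)` for `S 2`) whose
straightened structure on `↥(S m)` carries a handle decomposition with one `0`-handle and `k m`
`1`-handles (`exists_cornerSliceAtlas_hasHandleDecomposition_of_ambient` fed with
`SectorNormalForm.corner/half/morse`), is connected (`HasHandleDecomposition.connectedSpace`),
and has as boundary points exactly the points lying in another sector: a point of `↥(S m)` is a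
boundary point of the straightened structure iff it is not an interior point of `S m` in `X`
(`CornerSliceAtlas.isBoundaryPoint_of_mem`, `CornerSliceChart.not_mem_interior_of_mem_K` on the
corner locus; `CornerSliceAtlas.isInteriorPoint_iff_of_not_mem` +
`HalfSliceChart.apply_zero_pos_iff_mem_interior` off it), and the non-interior points of `S m`
are exactly the points of the other two sectors (interiors are disjoint from the other sectors,
`TriNormalForm.disjoint`; conversely the complement of the other two compact sectors is an open
subset of `S m`, `TriNormalForm.cover`).  This file declares the line's statement `ThetaData`
(verbatim from the checked skeleton) and proves the registered stub `stub_thetaData`.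
References: Gay–Kirby, Geom. Topol. 20 (2016), Def. 1 and Def. 8 [GayKirby2016];
Abrams–Gay–Kirby, Geom. Topol. 22 (2018), proof of Thm. 5 [AbramsGayKirby2018].
-/

noncomputable section

-- the prescribed namespace `Summit.<P>.<Sub>.…` duplicates `SmoothPoincare4` (P = Sub)
set_option linter.dupNamespace false

open Set Function ContinuousMap
open scoped Manifold ContDiff Topology

namespace Summit.SmoothPoincare4.SmoothPoincare4.Cruxes.AgkCor6Sufficiency.LpBySphereSystemSurgery

open Literature.Topology.FourManifolds

/-! ## The statement (verbatim from the skeleton) -/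

/-- **Θ-standard data of a Gay–Kirby trisection** (r5, tree plumbing): one normal frame
`(u, v, ρ, U, O)` along `F = ⋂ S l` in which the three sectors are the three fixed linear wedges
(`TriNormalForm S 0 1 2`), and for each sector a corner-slice atlas over that frame (relabelled
coordinates for `S 1`, `S 2`) whose straightened structure on `↥(S m)` carries a handle
decomposition with one `0`-handle and `k m` `1`-handles, is compact and connected, and has as
boundary points exactly the points lying in another sector.
(`IsGKTrisection.exists_triNormalForm`; `exists_cornerSliceAtlas_hasHandleDecomposition_of_ambient`
fed with `SectorNormalForm.corner/half/morse`; `HasHandleDecomposition.connectedSpace`;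
`CornerSliceAtlas.isBoundaryPoint_iff_of_not_mem` + `HalfSliceChart.apply_zero_pos_iff_mem_interior`.) -/
def ThetaData : Prop :=
  ∀ (X : Type) [TopologicalSpace X] [T2Space X] [CompactSpace X]
    [ChartedSpace (EuclideanSpace ℝ (Fin 4)) X] [IsManifold (𝓡 4) ∞ X]
    (g : ℕ) (k : Fin 3 → ℕ) (S : Fin 3 → Set X) (_ : IsGKTrisection X g k S),
    ∃ (u v : X → ℝ) (U O : Set X) (ρ : X → X)
      (Φ₀ : CornerSliceAtlas (S 0) (⋂ l, S l) u v ρ)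
      (Φ₁ : CornerSliceAtlas (S 1) (⋂ l, S l) (fun y => v y - u y) (fun y => -u y) ρ)
      (Φ₂ : CornerSliceAtlas (S 2) (⋂ l, S l) (fun y => -v y) (fun y => u y - v y) ρ),
      TriNormalForm S 0 1 2 u v ρ U O (fun m => handleCount 1 (k m)) ∧
      (letI := Φ₀.chartedSpace
       HasHandleDecomposition 3 ↥(S 0) (handleCount 1 (k 0)) ∧ ConnectedSpace ↥(S 0) ∧
        ∀ p : ↥(S 0), p ∈ (𝓡∂ 4).boundary ↥(S 0) ↔ ∃ j : Fin 3, j ≠ 0 ∧ p.1 ∈ S j) ∧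
      (letI := Φ₁.chartedSpace
       HasHandleDecomposition 3 ↥(S 1) (handleCount 1 (k 1)) ∧ ConnectedSpace ↥(S 1) ∧
        ∀ p : ↥(S 1), p ∈ (𝓡∂ 4).boundary ↥(S 1) ↔ ∃ j : Fin 3, j ≠ 1 ∧ p.1 ∈ S j) ∧
      (letI := Φ₂.chartedSpace
       HasHandleDecomposition 3 ↥(S 2) (handleCount 1 (k 2)) ∧ ConnectedSpace ↥(S 2) ∧
        ∀ p : ↥(S 2), p ∈ (𝓡∂ 4).boundary ↥(S 2) ↔ ∃ j : Fin 3, j ≠ 2 ∧ p.1 ∈ S j)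

/-! ## One sector -/

/-- **The non-interior points of a sector of a trisection in normal form are the points of the
other sectors.**  A point of `X` is not an interior point of `S m` iff it lies in some `S j`,
`j ≠ m`: interiors are disjoint from the other sectors (`TriNormalForm.disjoint`), and the
complement of the other two (compact, hence closed) sectors is an open set contained in `S m`
(`TriNormalForm.cover`). [cite: GayKirby2016, Def. 1] -/
theorem not_mem_interior_iff_exists_mem {X : Type} [TopologicalSpace X] [T2Space X]
    [ChartedSpace (EuclideanSpace ℝ (Fin 4)) X]
    {S : Fin 3 → Set X} {i j l : Fin 3} {u v : X → ℝ} {ρ : X → X} {U O : Set X}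
    {c : Fin 3 → ℕ → ℕ} (hT : TriNormalForm S i j l u v ρ U O c) (m : Fin 3) (y : X) :
    y ∉ interior (S m) ↔ ∃ j : Fin 3, j ≠ m ∧ y ∈ S j := by
  constructor
  · intro hnint
    by_contra hno
    push Not at hno
    apply hnint
    -- the complement of the other sectors is an open subset of `S m` containing `y`
    have hcl : IsClosed (⋃ j ∈ {j : Fin 3 | j ≠ m}, S j) :=
      (Set.toFinite _).isClosed_biUnion fun j _ => (hT.isCompact j).isClosed
    refine mem_interior.2 ⟨(⋃ j ∈ {j : Fin 3 | j ≠ m}, S j)ᶜ, fun z hz => ?_, hcl.isOpen_compl,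
      fun hy' => ?_⟩
    · have hz' : z ∈ ⋃ n, S n := by rw [hT.cover]; exact mem_univ z
      obtain ⟨n, hn⟩ := mem_iUnion.1 hz'
      by_contra hzm
      have hnm : n ≠ m := fun h => hzm (h ▸ hn)
      exact hz (mem_biUnion (show n ∈ {j : Fin 3 | j ≠ m} from hnm) hn)
    · obtain ⟨n, hn, hyn⟩ := mem_iUnion₂.1 hy'
      exact hno n hn hyn
  · rintro ⟨n, hnm, hyn⟩
    exact hT.not_mem_interior_of_mem (Ne.symm hnm) hyn

/-- **Θ-standard data of one sector.**  For a trisection in normal form `hT` (indices `0, 1, 2`)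
and one of its sectors `S m` in sector normal form for normal coordinates `(u', v')` and the
common retraction `ρ` (`hT.sector_i/j/l`), with one `0`-handle prescribed (`c m 0 = 1`): a
corner-slice atlas `Φ` of `S m` over `(u', v', ρ)` whose straightened structure on `↥(S m)`
carries a handle decomposition with counts `c m`
(`exists_cornerSliceAtlas_hasHandleDecomposition_of_ambient`), is connected
(`HasHandleDecomposition.connectedSpace`), and whose boundary points are exactly the points of
the other sectors (boundary point iff non-interior point of `S m` in `X`, by
`CornerSliceAtlas.isBoundaryPoint_of_mem` / `isInteriorPoint_iff_of_not_mem` and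
`HalfSliceChart.apply_zero_pos_iff_mem_interior`; then `not_mem_interior_iff_exists_mem`).
[cite: GayKirby2016, Def. 1] -/
theorem exists_cornerSliceAtlas_sector {X : Type} [TopologicalSpace X] [T2Space X]
    [ChartedSpace (EuclideanSpace ℝ (Fin 4)) X] [IsManifold (𝓡 4) ∞ X]
    {S : Fin 3 → Set X} {i j l : Fin 3} {u v : X → ℝ} {ρ : X → X} {U O : Set X}
    {c : Fin 3 → ℕ → ℕ} (hT : TriNormalForm S i j l u v ρ U O c) {m : Fin 3} {u' v' : X → ℝ}
    (hS : SectorNormalForm (S m) (⋂ l, S l) u' v' ρ U O (c m)) (hc0 : c m 0 = 1) :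
    ∃ Φ : CornerSliceAtlas (S m) (⋂ l, S l) u' v' ρ,
      (letI := Φ.chartedSpace
       HasHandleDecomposition 3 ↥(S m) (c m) ∧ ConnectedSpace ↥(S m) ∧
        ∀ p : ↥(S m), p ∈ (𝓡∂ 4).boundary ↥(S m) ↔ ∃ j : Fin 3, j ≠ m ∧ p.1 ∈ S j) := by
  obtain ⟨G, κ, Oκ, hGs, hκs, hOκo, hFOκ, -, hκpos, hκρ, hGform, hb1, hi1, hb2, hi2, -, hc⟩ :=
    hS.morse
  have hcd : ∀ x ∈ ⋂ l, S l, ∃ C : CornerSliceChart (S m) (⋂ l, S l) u' v' ρ, x ∈ C.Θ.source :=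
    fun x hx => by obtain ⟨C, hxC, -⟩ := hS.corner x hx; exact ⟨C, hxC⟩
  obtain ⟨Φ, -, hHD⟩ := exists_cornerSliceAtlas_hasHandleDecomposition_of_ambient hcd hS.half hGs
    hOκo hFOκ hκs hκpos hκρ (fun y _ hy => hGform y hy) hb1 hi1 hb2 hi2 hc
  letI := Φ.chartedSpace
  haveI := Φ.isManifold
  haveI : CompactSpace ↥(S m) := isCompact_iff_compactSpace.1 hS.isCompact
  refine ⟨Φ, hHD, hHD.connectedSpace hc0, fun p => ?_⟩
  -- boundary points of the straightened structure are the non-interior points of `S m` in `X`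
  have hbd : (𝓡∂ 4).IsBoundaryPoint p ↔ p.1 ∉ interior (S m) := by
    by_cases hp : p.1 ∈ ⋂ l, S l
    · exact ⟨fun _ => (Φ.cornerDatum p hp).not_mem_interior_of_mem_K (Φ.corner_mem_source p hp) hp,
        fun _ => Φ.isBoundaryPoint_of_mem p hp⟩
    · rw [ModelWithCorners.isBoundaryPoint_iff_not_isInteriorPoint,
        Φ.isInteriorPoint_iff_of_not_mem p hp,
        (Φ.halfDatum p hp).apply_zero_pos_iff_mem_interior (Φ.half_mem_source p hp) p.2]
  show (𝓡∂ 4).IsBoundaryPoint p ↔ _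
  rw [hbd]
  exact not_mem_interior_iff_exists_mem hT m p.1

/-! ## The stub -/

/-- **stub — Θ-standard data** (r5): `IsGKTrisection.exists_triNormalForm` for the indices
`0, 1, 2`, then `exists_cornerSliceAtlas_sector` for the three sector normal forms
`hT.sector_i`, `hT.sector_j`, `hT.sector_l` (one `0`-handle each, `handleCount_zero`).
[cite: GayKirby2016, Def. 1 and Def. 8] -/
theorem stub_thetaData : ThetaData := by
  intro X _ _ _ _ _ g k S h
  obtain ⟨u, v, U, O, ρ, hT⟩ :=
    h.exists_triNormalForm (i := 0) (j := 1) (l := 2) (by decide) (by decide) (by decide)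
  obtain ⟨Φ₀, h₀⟩ := exists_cornerSliceAtlas_sector hT hT.sector_i (handleCount_zero 1 (k 0))
  obtain ⟨Φ₁, h₁⟩ := exists_cornerSliceAtlas_sector hT hT.sector_j (handleCount_zero 1 (k 1))
  obtain ⟨Φ₂, h₂⟩ := exists_cornerSliceAtlas_sector hT hT.sector_l (handleCount_zero 1 (k 2))
  exact ⟨u, v, U, O, ρ, Φ₀, Φ₁, Φ₂, hT, h₀, h₁, h₂⟩

end Summit.SmoothPoincare4.SmoothPoincare4.Cruxes.AgkCor6Sufficiency.LpBySphereSystemSurgery
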